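import Summits.Ventures.LatticeQCDFlow.Scaling.TaggedPerAttemptCertificateAdjacentDepth
import Summits.Ventures.LatticeQCDFlow.Scaling.TaggedPerAttemptCertificateBetween

/-!
HONEST FRAMING: exact (Metropolis-corrected) sampling algorithms for lattice gauge theory; figures
of merit are autocorrelation/cost numbers at stated couplings and volumes; no continuum-physics
claim.

# TaggedPerAttemptCertificateEveryEdge — CONJECTURE W′ ON EVERY ADJACENT EDGE (PRESENT CONTENTS BETWEEN THE EXTRA PARTICLES ALLOWED), FROM EVERY ORDINARY HUB EXCEPT THE ONE
# REMAINING CONFIGURATION «HUB ALONE STRICTLY BETWEEN THE EXTRA PARTICLES, EVERY OTHER PRESENT CONTENT STRICTLY BELOW IT», EVERY `K ≥ 2` (lean-2 GEN-42, ours)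

Venture-side (OURS).  Cell `lqcd-flow` (pub-lqcd), unit `pub-lqcd-lean-2-g42`, 2026-08-30.  Chapter AB (route (β), the cost side continued), file 13 — the assembly on arbitrary
edges.  For W14∕W26's tagged chains of an adjacent pair (`W_b ≤ W_a`, ANY present contents between) from an ordinary hub `z`: hub at or above `W_a` — file 10; hub below `W_a`
with a third particle at or above `W_z` (tie included) — file 6 if `W_z ≤ W_b`, file 12 if `W_b < W_z`; hub alone (`N_C(z) = 1`, every other present content strictly below
`W_z`) — then either `W_z ≤ W_b`, no content lies strictly between the extra particles and file 7b (the residual pair) applies, or `W_b < W_z < W_a`: the excluded configuration.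

* **`tagged_perAttempt_certificate_everyEdge`**: `cost(x̃) + cost(ỹ) ≤ L·(x̃(★) + (x̃(a) − ỹ(a)) − D_J)` for every `J`, under
  `¬(W_b < W_z < W_a ∧ N_C(z) = 1 ∧ ∀ w ≠ z present, W_w < W_z)`.

The excluded configuration (memo MEMO-gen42 §5): there the deficit of the pair is the SIGNED sum of a residual-pair deficit (even attempts, `∝ acc(z,a)`) and a hub-above deficit (odd
attempts, independent of `acc(z,a)`), with large negative terms in between; the subadditive split used in file 12 is lossy and the income (`∝ acc(z,a)`) cannot pay the odd-attempt
budget alone; the signed `g`-form of GEN-41 file 2 exported to the tagged chains is what is needed.  Literature grade (cell rule): OWN; nothing cited; no new bib keys.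
-/

open Finset

namespace Summit.Ventures.LatticeQCDFlow.Scaling

section EveryEdge
variable {S : Type*} [Fintype S] [DecidableEq S]
variable {W θ : S → ℝ} {acc : S → S → ℝ} {p : ℝ} {K : ℕ} {NC : S → ℕ} {a b : S} {PX PY : Option S → Option S → ℝ}

/-- **CONJECTURE W′ ON EVERY EDGE FROM EVERY HUB BUT THE LONE HUB STRICTLY BETWEEN THE EXTRA PARTICLES, EVERY `K ≥ 2`** (see the module docstring). [ours] -/
theorem tagged_perAttempt_certificate_everyEdge (hW : ∀ v, 0 < W v) (hp0 : 0 ≤ p) (hp : ∀ v, p * W v ≤ 1) (hθ : ∀ v, θ v = 1 / (1 + p * W v))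
    (hacc : ∀ h v, acc h v = min 1 (W h / W v)) (hK : 2 ≤ K) (hNC : ∑ v, NC v = K) (hab : W b ≤ W a)
    (hPXoff : ∀ h v, h ≠ v → PX (some h) (some v) = if NC h = 0 then 0 else (NC v : ℝ) / K * acc h v)
    (hPXin : ∀ h, PX (some h) none = if NC h = 0 then 0 else acc h a / K)
    (hPXdiag : ∀ h, PX (some h) (some h) = 1 - (∑ v ∈ univ.erase h, PX (some h) (some v) + PX (some h) none))
    (hPXout : ∀ v, PX none (some v) = (NC v : ℝ) / K * acc a v) (hPXstay : PX none none = 1 - ∑ v, PX none (some v))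
    (hPYoff : ∀ h v, h ≠ v → PY (some h) (some v) = if NC h = 0 then 0 else (NC v : ℝ) / K * acc h v)
    (hPYin : ∀ h, PY (some h) none = if NC h = 0 then 0 else acc h b / K)
    (hPYdiag : ∀ h, PY (some h) (some h) = 1 - (∑ v ∈ univ.erase h, PY (some h) (some v) + PY (some h) none))
    (hPYout : ∀ v, PY none (some v) = (NC v : ℝ) / K * acc b v) (hPYstay : PY none none = 1 - ∑ v, PY none (some v))
    {z : S} (hz : NC z ≠ 0) (hlone : ¬ (W b < W z ∧ W z < W a ∧ NC z = 1 ∧ ∀ w, w ≠ z → NC w ≠ 0 → W w < W z))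
    {x y : ℕ → Option S → ℝ}
    (hx0 : ∀ v, x 0 v = if v = some z then 1 else 0) (hxs : ∀ n v, x (n + 1) v = ∑ h, x n h * PX h v)
    (hy0 : ∀ v, y 0 v = if v = some z then 1 else 0) (hys : ∀ n v, y (n + 1) v = ∑ h, y n h * PY h v)
    {M : ℝ} (hM : M = ∑ v, θ v * (NC v : ℝ) + θ a) {L : ℝ} (hL : L = 2 * K + M + (∑ v, θ v * (NC v : ℝ) + θ b))
    {σ : ℝ} (hσ0 : 0 ≤ σ) (hσ1 : σ < 1) {xt yt xs ys : Option S → ℝ}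
    (hxt : ∀ t, xt t = (1 - σ) * PX (some z) t + σ * ∑ t', xt t' * PX t' t) (hyt : ∀ t, yt t = (1 - σ) * PY (some z) t + σ * ∑ t', yt t' * PY t' t)
    (hxsr : ∀ t, xs t = (1 - σ) * PX none t + σ * ∑ t', xs t' * PX t' t) (hysr : ∀ t, ys t = (1 - σ) * PY none t + σ * ∑ t', ys t' * PY t' t) (J : ℕ) :
    (∑ v, xt (some v) * (1 - θ v) + xt none * (1 - θ a)) + (∑ v, yt (some v) * (1 - θ v) + yt none * (1 - θ b))
      ≤ L * (xt none + (xt (some a) - yt (some a)) - ∑ n ∈ range J, (1 - σ) * σ ^ n * max 0 (y (n + 1) (some z) - x (n + 1) (some z))) := by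
  by_cases haz : W a ≤ W z
  · -- the hub at or above `W_a` (file 10)
    exact tagged_perAttempt_certificate_above_global hW hp0 hp hθ hacc hK hNC hab hPXoff hPXin hPXdiag hPXout hPXstay hPYoff hPYin hPYdiag hPYout hPYstay
      hz haz hx0 hxs hy0 hys hM hL hσ0 hσ1 hxt hyt hxsr hysr J
  · have hza : W z < W a := lt_of_not_ge haz
    by_cases hthree : 2 ≤ NC z ∨ ∃ w, w ≠ z ∧ NC w ≠ 0 ∧ W z ≤ W w
    · by_cases hzb : W z ≤ W b
      · -- at most `W_b`, three particles at or above `z` (file 6)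
        exact tagged_perAttempt_certificate_global hW hp0 hp hθ hacc hK hNC hab hPXoff hPXin hPXdiag hPXout hPXstay hPYoff hPYin hPYdiag hPYout hPYstay
          hz hzb hza hthree hx0 hxs hy0 hys hM hL hσ0 hσ1 hxt hyt hxsr hysr J
      · -- strictly between, three particles at or above `z` (file 12)
        exact tagged_perAttempt_certificate_between hW hp0 hp hθ hacc hK hNC hab hPXoff hPXin hPXdiag hPXout hPXstay hPYoff hPYin hPYdiag hPYout hPYstay
          hz (le_of_lt (lt_of_not_ge hzb)) hza hthree hx0 hxs hy0 hys hM hL hσ0 hσ1 hxt hyt hxsr hysr J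
    · -- the hub alone, every other present content strictly below it
      have hz2 : ¬ 2 ≤ NC z := fun h => hthree (Or.inl h)
      have hz1 : NC z = 1 := by omega
      have hbelow : ∀ w, w ≠ z → NC w ≠ 0 → W w < W z := fun w hwz hNw =>
        lt_of_not_ge fun hle => hthree (Or.inr ⟨w, hwz, hNw, hle⟩)
      by_cases hzb : W z ≤ W b
      · -- the residual pair: no content lies strictly between the extra particles (file 7b)
        have hnone : ∀ w, NC w ≠ 0 → ¬ (W b < W w ∧ W w < W a) := by
          intro w hw hbw
          by_cases hwz : w = z
          · rw [hwz] at hbw; linarith [hbw.1]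
          · linarith [hbelow w hwz hw, hbw.1]
        exact tagged_perAttempt_certificate_residual hW hp0 hp hθ hacc hK hNC hab hnone hPXoff hPXin hPXdiag hPXout hPXstay hPYoff hPYin hPYdiag hPYout hPYstay
          hz1 hzb hza hbelow hx0 hxs hy0 hys hM hL hσ0 hσ1 hxt hyt hxsr hysr J
      · -- the excluded configuration
        exact absurd ⟨lt_of_not_ge hzb, hza, hz1, hbelow⟩ hlone

end EveryEdge

end Summit.Ventures.LatticeQCDFlow.Scaling
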